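import Literature.MathematicalPhysics.QuantumFieldTheory.Balaban1983to89.B12Eq311RemainderBound
import Literature.MathematicalPhysics.QuantumFieldTheory.Balaban1983to89.B12Lemma4Models

/-!
# `Balaban1983to89.B12Eq311Models` — T. Bałaban, *Renormalization group approach to lattice gauge field theories. I*,
Commun. Math. Phys. **109** (1987) 249–301 [Balaban1987RG1]: **the bound on the local remainder `𝐅(U, 𝐀)` of (3.11) in the
two MODELS of the projection `π` of the current (1.8)** — `π = id` (the `U(N)`-type model `B12RegularSpaces111Unitary.unitaryModel`,
`𝔤ᶜ = 𝔸`) and `π = slProj N`, the traceless part `X ↦ X − (tr X / N)·1` of `B12Lemma4Models` (the `SU(N)` model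
`B12RegularSpaces111SpecialUnitary.suModel`, `𝔤ᶜ = 𝔰𝔩(N, ℂ)`), i.e. `B12Eq311RemainderBound.norm_F311_le_linear` /
`norm_rem311_le_linear` with their two `π`-hypotheses (`‖πX‖ ≤ Cπ‖X‖`, `π ∘ Ad(U(b)⁻¹) = Ad(U(b)⁻¹) ∘ π`) DISCHARGED:
`Cπ = 1` trivially for `π = id`; `Cπ = 2` for `π = slProj N` in the operator norm (`norm_slProj_le`: `|tr X| ≤ N‖X‖`, `‖1‖ ≤ 1`)
and the `Ad`-equivariance from `B12Lemma4Models.slProj_conj`.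

HONEST FRAMING (cell `lit-balaban`, verbatim): statement-level skeleton of published theorems with citation tags; proofs where landed; nothing here is a claim about the Yang–Mills mass gap.

PDF held: `paper:balaban1987-cmp109-rg-i-small-field` (journal page = PDF page + 248); p. 261 ((1.8), «π denotes the projection in the
space of all complex N × N-matrices onto the algebra 𝔤ᶜ») and p. 272 ((3.11)–(3.14)) re-read by this unit.

THE PRINT, verbatim (p. 272): *«D^{ξ*}_{exp iξ𝐀U} ξ⁻²π Im ∂ exp iξ𝐀U = D^{ξ*}_U ξ⁻²π Im ∂U + D^{ξ*}_U D^ξ_U 𝐀 + 𝐅(U, 𝐀), (3.11) where 𝐅 is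
a local operator depending on U, ∂U, 𝐀, ∇^ξ_U𝐀 only.»*  The bound on `𝐅` is `B12Eq311RemainderBound.norm_F311_le` ([14] (1.54) for the
current with a general `ℂ`-linear `π`); here only its two `π`-hypotheses are discharged in the models, nothing else changes (the
background is still a general configuration of units with `‖U(b)^{±1}‖ ≤ ρ`, as in the complex spaces (1.11)–(1.14)).

THEOREMS (no definition, no `Prop` placeholder, no new fact; axioms standard): `norm_slProj_le` (`‖slProj N X‖ ≤ 2‖X‖` in the
`L²`-operator norm, scope `Matrix.Norms.L2Operator` — the norm of `B10Eq29TubeLine.cstarAlgebraMatrix` used by `B12Lemma4Models`); `norm_F311_le_linear_id` / `norm_rem311_le_linear_id` (`π = id`: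
`‖𝐅(U, 𝐀)(b)‖ ≤ (d − 1)·C_F(ρ)·α₂`); `norm_F311_le_linear_su` / `norm_rem311_le_linear_su` (`π = slProj N`:
`‖𝐅(U, 𝐀)(b)‖ ≤ (d − 1)·2C_F(ρ)·α₂`).  Unit `lit-balaban-p07` (Phase-2 seat p07 gen 7; row B12.Eq3.10-3.12, owners r09/r20; sequel of
`B12Eq311CurrentExpansion` / `…PlaquetteBounds` / `…LatticeBounds` / `…RemainderBound`), HOME `run/shared/lean/pub/lit-balaban/`.
-/

open NormedSpace Complex

namespace Literature.MathematicalPhysics.QuantumFieldTheory.Balaban1983to89.B12Eq311Models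

open Literature.MathematicalPhysics.QuantumFieldTheory.Balaban1983to89
open Literature.MathematicalPhysics.QuantumFieldTheory.Balaban1983to89.B9Eq39Adjoint
open Literature.MathematicalPhysics.QuantumFieldTheory.Balaban1983to89.B9TorusCalculus
open Literature.MathematicalPhysics.QuantumFieldTheory.Balaban1983to89.B12Eq311CurrentExpansion
open Literature.MathematicalPhysics.QuantumFieldTheory.Balaban1983to89.B12Eq311RemainderBound
open Literature.MathematicalPhysics.QuantumFieldTheory.Balaban1983to89.B12RegularSpaces111
open Literature.MathematicalPhysics.QuantumFieldTheory.Balaban1983to89.B12Lemma4Models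

noncomputable section

/-! ## §1. `π = id` (the `U(N)`-type model: `𝔤ᶜ = 𝔸`, no projection) -/

section Identity

variable {𝔸 : Type*} [NormedRing 𝔸] [NormedAlgebra ℂ 𝔸] [CompleteSpace 𝔸] {S : Type*} {ι : Type*} [Fintype ι] [LinearOrder ι]
variable (T : ι → Equiv.Perm S) (U : ι → S → 𝔸ˣ)
variable {ρ ξ α₀ α₂ : ℝ} {A : ι → S → 𝔸}

/-- **[B12 (3.11), `π = id`]** the linear bound on the local remainder `𝐅(U, 𝐀)` of (3.11) for the current without projection
(`𝔤ᶜ = 𝔸`, the `U(N)`-type model): `‖𝐅(U, 𝐀)(b)‖ ≤ (d − 1)·C_F(ρ)·α₂` under `0 < ξ ≤ 1`, `‖U(b)^{±1}‖ ≤ ρ` (`1 ≤ ρ`), `|𝐀| ≤ α₂`,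
`|D^ξ_U𝐀| ≤ ξα₂`, `|U(∂p) − 1| ≤ α₀ξ²`, `α₀, α₂ ≤ 1` — `B12Eq311RemainderBound.norm_F311_le_linear` with `Cπ = 1`.
[cite: Balaban1987RG1, (3.11)–(3.14) p.272; Balaban1985RegularSpaces, (1.54) p.85] -/
theorem norm_F311_le_linear_id (hξ : 0 < ξ) (hξ1 : ξ ≤ 1) (hρ : 1 ≤ ρ)
    (hU : ∀ μ x, ‖(U μ x : 𝔸)‖ ≤ ρ ∧ ‖(((U μ x)⁻¹ : 𝔸ˣ) : 𝔸)‖ ≤ ρ)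
    (hα₀ : 0 ≤ α₀) (hα₀1 : α₀ ≤ 1) (hα₂1 : α₂ ≤ 1)
    (hA : ∀ μ x, ‖A μ x‖ ≤ α₂) (hDA : ∀ κ ν y, ‖covD T U κ (A ν) y‖ ≤ ξ * α₂)
    (hP : ∀ κ ν, κ < ν → ∀ y, ‖(plaqU T U κ ν y : 𝔸) - 1‖ ≤ α₀ * ξ ^ 2) (μ : ι) (x : S) :
    ‖F311 T LinearMap.id ξ U A μ x‖ ≤ (Fintype.card ι - 1) * (C311 ρ * α₂) := by
  have h := norm_F311_le_linear T U (π := LinearMap.id) hξ hξ1 hρ hU hα₀ hα₀1 hα₂1 hA hDA hP zero_le_one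
    (fun X => by rw [LinearMap.id_apply, one_mul]) (fun _ _ _ => rfl) μ x
  rwa [one_mul] at h

variable {P : Params} {i : ℕ}

/-- **[B12 (3.11), `π = id`, on the torus]** the same in the letters of the spaces (1.11)–(1.14) (`B12RegularSpaces111.nabla`,
`B12RegularSpaces111.plaq`) for the torus current `B12Eq18Current.current id ξ U`: `‖𝐅(U, 𝐀)(b)‖ ≤ (d − 1)·C_F(ρ)·α₂` —
`B12Eq311RemainderBound.norm_rem311_le_linear` with `Cπ = 1`. [cite: Balaban1987RG1, (3.11)–(3.14) p.272] -/
theorem norm_rem311_le_linear_id {U : PBond P i → 𝔸ˣ} {A : PBond P i → 𝔸}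
    (hξ : 0 < ξ) (hξ1 : ξ ≤ 1) (hρ : 1 ≤ ρ) (hU : ∀ b, ‖(U b : 𝔸)‖ ≤ ρ ∧ ‖(((U b)⁻¹ : 𝔸ˣ) : 𝔸)‖ ≤ ρ)
    (hα₀ : 0 ≤ α₀) (hα₀1 : α₀ ≤ 1) (hα₂1 : α₂ ≤ 1) (hA : ∀ b, ‖A b‖ ≤ α₂)
    (hDA : ∀ μ ν x, ‖B12RegularSpaces111.nabla ξ U μ (fun y => A ⟨y, ν⟩) x‖ ≤ α₂)
    (hP : ∀ p : Plaq P i, ‖((B12RegularSpaces111.plaq U p : 𝔸ˣ) : 𝔸) - 1‖ ≤ α₀ * ξ ^ 2) (b : PBond P i) :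
    ‖rem311 LinearMap.id ξ U A b‖ ≤ (P.d - 1) * (C311 ρ * α₂) := by
  have h := norm_rem311_le_linear (π := LinearMap.id) hξ hξ1 hρ hU hα₀ hα₀1 hα₂1 hA hDA hP zero_le_one
    (fun X => by rw [LinearMap.id_apply, one_mul]) (fun _ _ => rfl) b
  rwa [one_mul] at h

end Identity

/-! ## §2. `π = slProj N` (the `SU(N)` model: `𝔤ᶜ = 𝔰𝔩(N, ℂ)`, operator norms on `M_N(ℂ)`) -/

section SpecialUnitary

open scoped Matrix.Norms.L2Operator

variable {N : ℕ}

/-- **The projection onto `𝔤ᶜ = 𝔰𝔩(N, ℂ)` is bounded by `2` in the operator norm**: `‖X − (tr X / N)·1‖ ≤ ‖X‖ + |tr X|/N ≤ 2‖X‖`,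
since every diagonal entry satisfies `|X_{ii}| ≤ ‖X‖` and `‖1‖ ≤ 1` (for `N = 0` everything is `0`). This is the constant `Cπ`
of `B12Eq311RemainderBound.norm_F311_le` in the `SU(N)` model. [cite: Balaban1987RG1, (1.8) p.261] -/
theorem norm_slProj_le (X : Matrix (Fin N) (Fin N) ℂ) : ‖slProj N X‖ ≤ 2 * ‖X‖ := by
  rw [slProj_apply]
  -- every entry is bounded by the operator norm: `X i j = (X e_j)_i`
  have hent : ∀ i j : Fin N, ‖X i j‖ ≤ ‖X‖ := fun i j => by
    have h := Matrix.l2_opNorm_mulVec X (EuclideanSpace.single j (1 : ℂ))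
    rw [PiLp.norm_single, norm_one, mul_one] at h
    refine le_trans ?_ h
    have hs : (⇑(EuclideanSpace.single j (1 : ℂ)) : Fin N → ℂ) = Pi.single j 1 :=
      funext fun k => by simp [Pi.single_apply, eq_comm]
    have h2 := PiLp.norm_apply_le ((EuclideanSpace.equiv (Fin N) ℂ).symm (X.mulVec ⇑(EuclideanSpace.single j (1 : ℂ)))) i
    have h3 : ((EuclideanSpace.equiv (Fin N) ℂ).symm (X.mulVec ⇑(EuclideanSpace.single j (1 : ℂ)))) i = X i j := by
      rw [hs, Matrix.mulVec_single_one]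
      rfl
    rwa [h3] at h2
  -- hence `|tr X| ≤ N‖X‖`
  have htr : ‖X.trace‖ ≤ N * ‖X‖ :=
    calc ‖X.trace‖ = ‖∑ i, X i i‖ := rfl
      _ ≤ ∑ i, ‖X i i‖ := norm_sum_le _ _
      _ ≤ ∑ _i : Fin N, ‖X‖ := Finset.sum_le_sum fun i _ => hent i i
      _ = N * ‖X‖ := by rw [Finset.sum_const, Finset.card_univ, Fintype.card_fin, nsmul_eq_mul]
  -- and `‖1‖ ≤ 1`
  have h1 : ‖(1 : Matrix (Fin N) (Fin N) ℂ)‖ ≤ 1 := by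
    rw [← Matrix.diagonal_one, Matrix.l2_opNorm_diagonal]
    exact (pi_norm_const_le (1 : ℂ)).trans_eq norm_one
  calc ‖X - ((N : ℂ)⁻¹ * X.trace) • (1 : Matrix (Fin N) (Fin N) ℂ)‖ ≤ ‖X‖ + ‖((N : ℂ)⁻¹ * X.trace) • (1 : Matrix (Fin N) (Fin N) ℂ)‖ := norm_sub_le _ _
    _ ≤ ‖X‖ + ‖X‖ := by
        refine add_le_add le_rfl ?_
        rw [norm_smul, norm_mul, norm_inv, Complex.norm_natCast]
        rcases Nat.eq_zero_or_pos N with hN | hN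
        · subst hN
          rw [Nat.cast_zero, inv_zero, zero_mul, zero_mul]
          exact norm_nonneg _
        · calc (N : ℝ)⁻¹ * ‖X.trace‖ * ‖(1 : Matrix (Fin N) (Fin N) ℂ)‖ ≤ (N : ℝ)⁻¹ * (N * ‖X‖) * 1 := by
                gcongr
              _ = ‖X‖ := by
                have hN' : (N : ℝ) ≠ 0 := Nat.cast_ne_zero.mpr hN.ne'
                field_simp
    _ = 2 * ‖X‖ := by ring

variable {S : Type*} {ι : Type*} [Fintype ι] [LinearOrder ι]
variable (T : ι → Equiv.Perm S) (U : ι → S → (Matrix (Fin N) (Fin N) ℂ)ˣ)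
variable {ρ ξ α₀ α₂ : ℝ} {A : ι → S → Matrix (Fin N) (Fin N) ℂ}

/-- **[B12 (3.11), `SU(N)` model]** the linear bound on the local remainder `𝐅(U, 𝐀)` of (3.11) for the current (1.8) with the
printed projection `π` onto `𝔤ᶜ = 𝔰𝔩(N, ℂ)` (`slProj N`), operator norms on `M_N(ℂ)`: `‖𝐅(U, 𝐀)(b)‖ ≤ (d − 1)·2C_F(ρ)·α₂` under
`0 < ξ ≤ 1`, `‖U(b)^{±1}‖ ≤ ρ` (`1 ≤ ρ`), `|𝐀| ≤ α₂`, `|D^ξ_U𝐀| ≤ ξα₂`, `|U(∂p) − 1| ≤ α₀ξ²`, `α₀, α₂ ≤ 1` —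
`B12Eq311RemainderBound.norm_F311_le_linear` with `Cπ = 2` (`norm_slProj_le`) and the `Ad`-equivariance `slProj_conj`.
[cite: Balaban1987RG1, (1.8) p.261, (3.11)–(3.14) p.272; Balaban1985RegularSpaces, (1.54) p.85] -/
theorem norm_F311_le_linear_su (hξ : 0 < ξ) (hξ1 : ξ ≤ 1) (hρ : 1 ≤ ρ)
    (hU : ∀ μ x, ‖(U μ x : Matrix (Fin N) (Fin N) ℂ)‖ ≤ ρ ∧ ‖(((U μ x)⁻¹ : (Matrix (Fin N) (Fin N) ℂ)ˣ) : Matrix (Fin N) (Fin N) ℂ)‖ ≤ ρ)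
    (hα₀ : 0 ≤ α₀) (hα₀1 : α₀ ≤ 1) (hα₂1 : α₂ ≤ 1)
    (hA : ∀ μ x, ‖A μ x‖ ≤ α₂) (hDA : ∀ κ ν y, ‖covD T U κ (A ν) y‖ ≤ ξ * α₂)
    (hP : ∀ κ ν, κ < ν → ∀ y, ‖(plaqU T U κ ν y : Matrix (Fin N) (Fin N) ℂ) - 1‖ ≤ α₀ * ξ ^ 2) (μ : ι) (x : S) :
    ‖F311 T (slProj N) ξ U A μ x‖ ≤ (Fintype.card ι - 1) * (2 * C311 ρ * α₂) :=
  norm_F311_le_linear T U (π := slProj N) hξ hξ1 hρ hU hα₀ hα₀1 hα₂1 hA hDA hP zero_le_two norm_slProj_le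
    (fun μ x X => slProj_conj (U μ x)⁻¹ X) μ x

variable {P : Params} {i : ℕ}

/-- **[B12 (3.11), `SU(N)` model, on the torus]** the same in the letters of the spaces (1.11)–(1.14) for the torus current
`B12Eq18Current.current (slProj N) ξ U` of the `SU(N)` model (`B12Lemma4Models`): `‖𝐅(U, 𝐀)(b)‖ ≤ (d − 1)·2C_F(ρ)·α₂` —
`B12Eq311RemainderBound.norm_rem311_le_linear` with `Cπ = 2` and `slProj_conj`. [cite: Balaban1987RG1, (1.8) p.261, (3.11)–(3.14) p.272] -/
theorem norm_rem311_le_linear_su {U : PBond P i → (Matrix (Fin N) (Fin N) ℂ)ˣ} {A : PBond P i → Matrix (Fin N) (Fin N) ℂ}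
    (hξ : 0 < ξ) (hξ1 : ξ ≤ 1) (hρ : 1 ≤ ρ) (hU : ∀ b, ‖(U b : Matrix (Fin N) (Fin N) ℂ)‖ ≤ ρ ∧ ‖(((U b)⁻¹ : (Matrix (Fin N) (Fin N) ℂ)ˣ) : Matrix (Fin N) (Fin N) ℂ)‖ ≤ ρ)
    (hα₀ : 0 ≤ α₀) (hα₀1 : α₀ ≤ 1) (hα₂1 : α₂ ≤ 1) (hA : ∀ b, ‖A b‖ ≤ α₂)
    (hDA : ∀ μ ν x, ‖B12RegularSpaces111.nabla ξ U μ (fun y => A ⟨y, ν⟩) x‖ ≤ α₂)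
    (hP : ∀ p : Plaq P i, ‖((B12RegularSpaces111.plaq U p : (Matrix (Fin N) (Fin N) ℂ)ˣ) : Matrix (Fin N) (Fin N) ℂ) - 1‖ ≤ α₀ * ξ ^ 2) (b : PBond P i) :
    ‖rem311 (slProj N) ξ U A b‖ ≤ (P.d - 1) * (2 * C311 ρ * α₂) :=
  norm_rem311_le_linear (π := slProj N) hξ hξ1 hρ hU hα₀ hα₀1 hα₂1 hA hDA hP zero_le_two norm_slProj_le
    (fun b X => slProj_conj (U b)⁻¹ X) b

end SpecialUnitary

end

end Literature.MathematicalPhysics.QuantumFieldTheory.Balaban1983to89.B12Eq311Models
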